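import Literature.NumberTheory.Transcendental.NesterenkoElimIdealPrime
import Literature.AlgebraicGeometry.Motives.ProjectiveSpaceDehomogenize
import Mathlib.RingTheory.Polynomial.Basic
import Mathlib.RingTheory.Localization.Away.Basic
import Mathlib.RingTheory.Localization.Ideal
import HarnessLib

/-!
# Affine charts for Nesterenko's elimination ideal `Ī(r)` over an ARBITRARY field (LNM 1752 Ch. 3 §4, Def. 4.3)

`Literature/NumberTheory/Transcendental/NesterenkoEliminationChartsK.lean`. GENERIC-FIELD PORT of the
tree's `NesterenkoEliminationCharts.lean` (which is hard-wired to `ℚ[x̲]`): the same definitions and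
proofs with `ℚ ↦ K`, `K` any field, for the generic objects `NesterenkoK.linForm`,
`NesterenkoK.extIdeal I r = (I, L₁, …, L_r)`, `NesterenkoK.elimIdeal I r = Ī(r)` of
`NesterenkoElimIdealPrime.lean` (`K[x̲] = MvPolynomial (Fin (m + 1)) K`,
`K[U] = MvPolynomial (Fin r × Fin (m + 1)) K`). Chapter 10 of the book runs Ch. 3 §4 over
`K = ℂ(z)` (p. 153); this is the chart toolkit of the generic-field proof of Proposition 4.4
(`NesterenkoEliminationPrimaryFormK.lean`). The maps `wForm`, `sigmaUVal`, `sigmaU`, `sigmaUX` take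
the field `K` explicitly.

Fix a chart `c` (the open set `x_c ≠ 0` of `P^m`). Dehomogenising at `x_c`
(`Literature.AlgebraicGeometry.Motives.ProjectiveSpace.dehomogenize K c : K[x̲] → K[y₁, …, y_m]`,
`x_c ↦ 1`, `x_{c.succAbove j} ↦ y_j`) and SOLVING the linear forms `Lᵢ = ∑ⱼ u_{ij} xⱼ = 0` for the
variables `u_{ic}` gives the `K`-algebra map

  `σ_c : K[U] → T := K[y][u_{ij} : j ≠ c]`, `u_{ij} ↦ u_{ij}` (`j ≠ c`), `u_{ic} ↦ wᵢ := −∑_{j ≠ c} u_{ij} yⱼ`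

(`sigmaU`; its extension `sigmaUX` to `K[U, x̲]` kills every `Lᵢ`). The main result of this file is
the chart description of `Ī(r)` for a HOMOGENEOUS ideal `J`:

  `G ∈ Ī(r) ⟺ ∀ c, σ_c(G) ∈ J'_c · T`,  `J'_c = dehomogenize_c(J)`

(`mem_elimIdeal_iff_forall_sigmaU_mem`): `⟹` by applying `sigmaUX`; `⟸` by re-homogenising in the
localisation `K[U, x̲][1/x_c]` (Euler's identity `P = x_cᵉ P(x/x_c)` for forms `P ∈ J`, and
`u_{ic} ≡ σ_c(u_{ic}) mod Lᵢ/x_c`). Together with the standard dictionary between homogeneous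
ideals of `K[x̲]` not containing `x_c` and ideals of `K[y]` (`isPrime_affIdeal`,
`isPrimary_affIdeal`, `radical_affIdeal`, `mem_of_dehomogenize_mem_affIdeal`) this reduces
Proposition 4.4 to commutative algebra in the polynomial ring `T` over the affine coordinate ring,
carried out (over `K`) in `NesterenkoChowFormPrime.lean` (prime ideals) and
`NesterenkoEliminationPrimaryFormK.lean` (primary ideals).

Everything here is proved; the only definitions are the plumbing maps `affIdeal`, `wForm`,
`sigmaU`, `sigmaUX` (no named facts).

## References

* [NesterenkoPhilippon2001] Yu. V. Nesterenko, P. Philippon (eds.), *Introduction to Algebraic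
  Independence Theory*, LNM 1752, Springer 2001, Ch. 3 §4, Def. 4.3 and Prop. 4.4 (p. 38).
* [Hartshorne1977] R. Hartshorne, *Algebraic Geometry*, I §2 (proof of Prop. 2.2: homogenisation and
  dehomogenisation), for the dictionary `J ↦ J'`.
-/

noncomputable section

open MvPolynomial
open Literature.AlgebraicGeometry.Motives

attribute [local instance] MvPolynomial.gradedAlgebra

namespace Literature.NumberTheory.Transcendental

namespace NesterenkoK

variable {K : Type*} [Field K] {m : ℕ}

/-! ### The affine coordinate ring of a chart and the dehomogenised ideal -/



/-- The dehomogenised ideal `J' = {P(x_c := 1) : P ∈ J}` of the chart `x_c ≠ 0` (the image of `J`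
under `ProjectiveSpace.dehomogenize K c`). [cite: Hartshorne1977, I §2 (proof of Prop. 2.2)] -/
def affIdeal (c : Fin (m + 1)) (J : Ideal (MvPolynomial (Fin (m + 1)) K)) : Ideal ((MvPolynomial (Fin m) K)) :=
  J.map (ProjectiveSpace.dehomogenize K c)

/-- Dehomogenisation is surjective (`g = (g(x_{c.succAbove ·}))(x_c := 1)`). [folklore] -/
theorem dehomogenize_surjective (c : Fin (m + 1)) :
    Function.Surjective (ProjectiveSpace.dehomogenize K c : (MvPolynomial (Fin (m + 1)) K) → (MvPolynomial (Fin m) K)) := fun g =>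
  ⟨rename c.succAbove g, ProjectiveSpace.dehomogenize_rename_succAbove K c g⟩

/-- Membership in `J'`: `a ∈ J'` iff `a = P(x_c := 1)` for some `P ∈ J`. [folklore] -/
theorem mem_affIdeal_iff (c : Fin (m + 1)) (J : Ideal (MvPolynomial (Fin (m + 1)) K)) (a : (MvPolynomial (Fin m) K)) :
    a ∈ affIdeal c J ↔ ∃ P ∈ J, ProjectiveSpace.dehomogenize K c P = a :=
  Ideal.mem_map_iff_of_surjective _ (dehomogenize_surjective c)

/-- `P ∈ J ⇒ P(x_c := 1) ∈ J'`. [folklore] -/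
theorem dehomogenize_mem_affIdeal (c : Fin (m + 1)) {J : Ideal (MvPolynomial (Fin (m + 1)) K)} {P : (MvPolynomial (Fin (m + 1)) K)} (hP : P ∈ J) :
    ProjectiveSpace.dehomogenize K c P ∈ affIdeal c J :=
  Ideal.mem_map_of_mem _ hP

/-- `affIdeal` is monotone in the ideal. [folklore] -/
theorem affIdeal_mono (c : Fin (m + 1)) {I J : Ideal (MvPolynomial (Fin (m + 1)) K)} (h : I ≤ J) : affIdeal c I ≤ affIdeal c J :=
  Ideal.map_mono h

/-- A chart on which `x_c ∈ J` sees nothing: `J' = ⊤` (as `x_c ↦ 1`). [folklore] -/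
theorem affIdeal_eq_top_of_X_mem (c : Fin (m + 1)) {J : Ideal (MvPolynomial (Fin (m + 1)) K)} (h : (X c : (MvPolynomial (Fin (m + 1)) K)) ∈ J) :
    affIdeal c J = ⊤ := by
  rw [Ideal.eq_top_iff_one]
  have := dehomogenize_mem_affIdeal c h
  rwa [ProjectiveSpace.dehomogenize_X_self] at this

/-- The homogeneous components of an element of a homogeneous ideal lie in it. [folklore] -/
theorem homogeneousComponent_mem_of_isHomogeneous {J : Ideal (MvPolynomial (Fin (m + 1)) K)}
    (hJ : J.IsHomogeneous (homogeneousSubmodule (Fin (m + 1)) K)) {P : (MvPolynomial (Fin (m + 1)) K)} (hP : P ∈ J) (k : ℕ) :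
    homogeneousComponent k P ∈ J := by
  have e : (DirectSum.decompose (homogeneousSubmodule (Fin (m + 1)) K) P k : (MvPolynomial (Fin (m + 1)) K)) =
      homogeneousComponent k P :=
    weightedDecomposition.decompose'_apply K (1 : Fin (m + 1) → ℕ) P k
  rw [← e]
  exact (hJ.mem_iff.mp hP) k

/-- **Re-homogenisation.** If `J` is a homogeneous ideal and the dehomogenisation of a FORM `P` lies
in `J'`, then `x_cⁿ P ∈ J` for some `n` (lift `P(x_c := 1) = P₀(x_c := 1)`, `P₀ ∈ J`; pad the
homogeneous components of `P₀` with powers of `x_c` to a form of `J` of large degree `N`, and compare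
it with `x_c^{N − e} P`: forms of equal degree with equal dehomogenisations are equal).
[cite: Hartshorne1977, I §2 (proof of Prop. 2.2)] -/
theorem exists_X_pow_mul_mem_of_dehomogenize_mem (c : Fin (m + 1)) {J : Ideal (MvPolynomial (Fin (m + 1)) K)}
    (hJ : J.IsHomogeneous (homogeneousSubmodule (Fin (m + 1)) K)) {P : (MvPolynomial (Fin (m + 1)) K)} {e : ℕ}
    (hP : P.IsHomogeneous e) (h : ProjectiveSpace.dehomogenize K c P ∈ affIdeal c J) :
    ∃ n : ℕ, X c ^ n * P ∈ J := by
  classical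
  obtain ⟨P₀, hP₀J, hP₀⟩ := (mem_affIdeal_iff c J _).mp h
  set N := max P₀.totalDegree e with hN
  -- the padded form `H = ∑_k x_c^{N-k} (P₀)_k ∈ J`, homogeneous of degree `N`
  set H : (MvPolynomial (Fin (m + 1)) K) := ∑ k ∈ Finset.range (P₀.totalDegree + 1),
    X c ^ (N - k) * homogeneousComponent k P₀ with hH
  have hcomp : ∀ k, homogeneousComponent k P₀ ∈ J := fun k =>
    homogeneousComponent_mem_of_isHomogeneous hJ hP₀J k
  have hHJ : H ∈ J := Ideal.sum_mem _ fun k _ => Ideal.mul_mem_left _ _ (hcomp k)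
  have hHhom : H.IsHomogeneous N := by
    refine IsHomogeneous.sum _ _ _ fun k hk => ?_
    have hk' : k ≤ N := (Nat.lt_succ_iff.mp (Finset.mem_range.mp hk)).trans (le_max_left _ _)
    have h1 : (X c ^ (N - k) : (MvPolynomial (Fin (m + 1)) K)).IsHomogeneous (1 * (N - k)) := (isHomogeneous_X K c).pow _
    have := h1.mul (homogeneousComponent_isHomogeneous k P₀)
    rwa [one_mul, Nat.sub_add_cancel hk'] at this
  have hHd : ProjectiveSpace.dehomogenize K c H = ProjectiveSpace.dehomogenize K c P := by
    rw [hH, map_sum]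
    have : ∀ k ∈ Finset.range (P₀.totalDegree + 1), ProjectiveSpace.dehomogenize K c
        (X c ^ (N - k) * homogeneousComponent k P₀) =
        ProjectiveSpace.dehomogenize K c (homogeneousComponent k P₀) := fun k _ => by
      rw [map_mul, map_pow, ProjectiveSpace.dehomogenize_X_self, one_pow, one_mul]
    rw [Finset.sum_congr rfl this, ← map_sum, sum_homogeneousComponent, hP₀]
  -- compare with `x_c^{N-e} P`
  have hXP : (X c ^ (N - e) * P : (MvPolynomial (Fin (m + 1)) K)).IsHomogeneous N := by
    have h1 : (X c ^ (N - e) : (MvPolynomial (Fin (m + 1)) K)).IsHomogeneous (1 * (N - e)) := (isHomogeneous_X K c).pow _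
    have := h1.mul hP
    rwa [one_mul, Nat.sub_add_cancel (le_max_right _ _)] at this
  refine ⟨N - e, ?_⟩
  have heq : X c ^ (N - e) * P = H := by
    refine ProjectiveSpace.eq_of_dehomogenize_eq c hXP hHhom ?_
    rw [hHd, map_mul, map_pow, ProjectiveSpace.dehomogenize_X_self, one_pow, one_mul]
  rw [heq]
  exact hHJ

/-- If moreover `x_c` is a non-zero-divisor modulo `J` (`x_c P ∈ J ⇒ P ∈ J`), then for forms `P`:
`P(x_c := 1) ∈ J' ⟺ P ∈ J`. [cite: Hartshorne1977, I §2 (proof of Prop. 2.2)] -/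
theorem mem_of_dehomogenize_mem_affIdeal (c : Fin (m + 1)) {J : Ideal (MvPolynomial (Fin (m + 1)) K)}
    (hJ : J.IsHomogeneous (homogeneousSubmodule (Fin (m + 1)) K))
    (hsat : ∀ P : (MvPolynomial (Fin (m + 1)) K), X c * P ∈ J → P ∈ J) {P : (MvPolynomial (Fin (m + 1)) K)} {e : ℕ} (hP : P.IsHomogeneous e)
    (h : ProjectiveSpace.dehomogenize K c P ∈ affIdeal c J) : P ∈ J := by
  obtain ⟨n, hn⟩ := exists_X_pow_mul_mem_of_dehomogenize_mem c hJ hP h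
  induction n with
  | zero => simpa using hn
  | succ n ih => exact ih (hsat _ (by rw [← mul_assoc, ← pow_succ']; exact hn))

/-- Every element of `K[y]` is the dehomogenisation of a FORM (of degree its total degree).
[folklore] -/
theorem exists_isHomogeneous_dehomogenize_eq' (c : Fin (m + 1)) (a : (MvPolynomial (Fin m) K)) :
    ∃ P : (MvPolynomial (Fin (m + 1)) K), P.IsHomogeneous a.totalDegree ∧ ProjectiveSpace.dehomogenize K c P = a :=
  ProjectiveSpace.exists_isHomogeneous_dehomogenize_eq K c a le_rfl

/-- In a prime ideal not containing `x_c`, powers of `x_c` can be cancelled. [folklore] -/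
theorem mem_of_X_pow_mul_mem_of_isPrime {𝔭 : Ideal (MvPolynomial (Fin (m + 1)) K)} (h𝔭 : 𝔭.IsPrime) {c : Fin (m + 1)}
    (hc : (X c : (MvPolynomial (Fin (m + 1)) K)) ∉ 𝔭) {P : (MvPolynomial (Fin (m + 1)) K)} {n : ℕ} (h : X c ^ n * P ∈ 𝔭) : P ∈ 𝔭 :=
  (h𝔭.mem_or_mem h).resolve_left fun h' => hc (h𝔭.mem_of_pow_mem n h')

/-- **The dehomogenisation of a homogeneous prime not containing `x_c` is prime.**
[cite: Hartshorne1977, I §2 (proof of Prop. 2.2) and Ex. 2.10] -/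
theorem isPrime_affIdeal {𝔭 : Ideal (MvPolynomial (Fin (m + 1)) K)} (h𝔭 : 𝔭.IsPrime)
    (hhom : 𝔭.IsHomogeneous (homogeneousSubmodule (Fin (m + 1)) K)) {c : Fin (m + 1)}
    (hc : (X c : (MvPolynomial (Fin (m + 1)) K)) ∉ 𝔭) : (affIdeal c 𝔭).IsPrime := by
  refine ⟨?_, fun {a b} hab => ?_⟩
  · rw [Ne, Ideal.eq_top_iff_one]
    intro h1
    have h1' : ProjectiveSpace.dehomogenize K c (1 : (MvPolynomial (Fin (m + 1)) K)) ∈ affIdeal c 𝔭 := by rwa [map_one]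
    obtain ⟨n, hn⟩ := exists_X_pow_mul_mem_of_dehomogenize_mem c hhom (isHomogeneous_one _ _) h1'
    exact hc (h𝔭.mem_of_pow_mem n (by simpa using hn))
  · obtain ⟨A, hA, rfl⟩ := exists_isHomogeneous_dehomogenize_eq' c a
    obtain ⟨B, hB, rfl⟩ := exists_isHomogeneous_dehomogenize_eq' c b
    rw [← map_mul] at hab
    obtain ⟨n, hn⟩ := exists_X_pow_mul_mem_of_dehomogenize_mem c hhom (hA.mul hB) hab
    rcases h𝔭.mem_or_mem (mem_of_X_pow_mul_mem_of_isPrime h𝔭 hc hn) with h | h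
    · exact Or.inl (dehomogenize_mem_affIdeal c h)
    · exact Or.inr (dehomogenize_mem_affIdeal c h)

/-- For a homogeneous prime `𝔭 ∌ x_c` and a form `P`: `P(x_c := 1) ∈ 𝔭'` iff `P ∈ 𝔭`. [folklore] -/
theorem dehomogenize_mem_affIdeal_iff_of_isPrime {𝔭 : Ideal (MvPolynomial (Fin (m + 1)) K)} (h𝔭 : 𝔭.IsPrime)
    (hhom : 𝔭.IsHomogeneous (homogeneousSubmodule (Fin (m + 1)) K)) {c : Fin (m + 1)}
    (hc : (X c : (MvPolynomial (Fin (m + 1)) K)) ∉ 𝔭) {P : (MvPolynomial (Fin (m + 1)) K)} {e : ℕ} (hP : P.IsHomogeneous e) :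
    ProjectiveSpace.dehomogenize K c P ∈ affIdeal c 𝔭 ↔ P ∈ 𝔭 :=
  ⟨mem_of_dehomogenize_mem_affIdeal c hhom
    (fun _ hQ => (h𝔭.mem_or_mem hQ).resolve_left hc) hP, dehomogenize_mem_affIdeal c⟩

/-- In a primary ideal whose radical does not contain `x_c`, powers of `x_c` can be cancelled.
[folklore] -/
theorem mem_of_X_pow_mul_mem_of_isPrimary {Q : Ideal (MvPolynomial (Fin (m + 1)) K)} (hQ : Q.IsPrimary) {c : Fin (m + 1)}
    (hc : (X c : (MvPolynomial (Fin (m + 1)) K)) ∉ Q.radical) {P : (MvPolynomial (Fin (m + 1)) K)} {n : ℕ} (h : X c ^ n * P ∈ Q) : P ∈ Q := by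
  rw [mul_comm] at h
  rcases (Ideal.isPrimary_iff.mp hQ).2 h with h' | h'
  · exact h'
  · exact absurd (Ideal.mem_radical_of_pow_mem (by simpa using h' : X c ^ n ∈ Q.radical)) hc

/-- **The dehomogenisation of a homogeneous primary ideal `Q` with `x_c ∉ √Q` is primary**, and
`√(Q') = (√Q)'`. [cite: Hartshorne1977, I §2 (proof of Prop. 2.2)] -/
theorem isPrimary_affIdeal {Q : Ideal (MvPolynomial (Fin (m + 1)) K)} (hQ : Q.IsPrimary)
    (hhom : Q.IsHomogeneous (homogeneousSubmodule (Fin (m + 1)) K)) {c : Fin (m + 1)}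
    (hc : (X c : (MvPolynomial (Fin (m + 1)) K)) ∉ Q.radical) : (affIdeal c Q).IsPrimary := by
  rw [Ideal.isPrimary_iff]
  refine ⟨?_, fun {a b} hab => ?_⟩
  · rw [Ne, Ideal.eq_top_iff_one]
    intro h1
    have h1' : ProjectiveSpace.dehomogenize K c (1 : (MvPolynomial (Fin (m + 1)) K)) ∈ affIdeal c Q := by rwa [map_one]
    obtain ⟨n, hn⟩ := exists_X_pow_mul_mem_of_dehomogenize_mem c hhom (isHomogeneous_one _ _) h1'
    exact hc ⟨n, by simpa using hn⟩
  · obtain ⟨A, hA, rfl⟩ := exists_isHomogeneous_dehomogenize_eq' c a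
    obtain ⟨B, hB, rfl⟩ := exists_isHomogeneous_dehomogenize_eq' c b
    rw [← map_mul] at hab
    obtain ⟨n, hn⟩ := exists_X_pow_mul_mem_of_dehomogenize_mem c hhom (hA.mul hB) hab
    have hAB : A * B ∈ Q := mem_of_X_pow_mul_mem_of_isPrimary hQ hc hn
    rcases (Ideal.isPrimary_iff.mp hQ).2 hAB with h | h
    · exact Or.inl (dehomogenize_mem_affIdeal c h)
    · exact Or.inr (Ideal.map_radical_le _ (dehomogenize_mem_affIdeal c h))

/-- `√(Q') = (√Q)'` for a homogeneous primary `Q` with `x_c ∉ √Q`. [folklore] -/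
theorem radical_affIdeal {Q : Ideal (MvPolynomial (Fin (m + 1)) K)} (hQ : Q.IsPrimary)
    (hhom : Q.IsHomogeneous (homogeneousSubmodule (Fin (m + 1)) K)) {c : Fin (m + 1)}
    (hc : (X c : (MvPolynomial (Fin (m + 1)) K)) ∉ Q.radical) : (affIdeal c Q).radical = affIdeal c Q.radical := by
  refine le_antisymm ?_ (Ideal.map_radical_le _)
  intro a ha
  obtain ⟨n, hn⟩ := ha
  obtain ⟨A, hA, rfl⟩ := exists_isHomogeneous_dehomogenize_eq' c a
  rw [← map_pow] at hn
  obtain ⟨k, hk⟩ := exists_X_pow_mul_mem_of_dehomogenize_mem c hhom (hA.pow n) hn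
  exact dehomogenize_mem_affIdeal c ⟨n, mem_of_X_pow_mul_mem_of_isPrimary hQ hc hk⟩

/-! ### The substitution `σ_c` solving the linear forms -/

variable (K) in
/-- `wᵢ = −∑_{j ≠ c} u_{ij} yⱼ ∈ T`: the value of `u_{ic}` forced by `Lᵢ = 0` on the chart `x_c = 1`.
[cite: NesterenkoPhilippon2001, Ch. 3 Def. 4.3 (p. 38)] -/
def wForm (r m : ℕ) (i : Fin r) : (MvPolynomial (Fin r × Fin m) (MvPolynomial (Fin m) K)) :=
  -∑ j : Fin m, X (i, j) * C (X j)

variable (K) in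
/-- The images of the variables `u_{ij}` under `σ_c`: `u_{i, c.succAbove j'} ↦ u_{i j'}`,
`u_{ic} ↦ wᵢ`. [folklore] -/
def sigmaUVal (r m : ℕ) (c : Fin (m + 1)) (v : Fin r × Fin (m + 1)) : (MvPolynomial (Fin r × Fin m) (MvPolynomial (Fin m) K)) :=
  Fin.insertNth (α := fun _ => (MvPolynomial (Fin r × Fin m) (MvPolynomial (Fin m) K))) c (wForm K r m v.1) (fun j => X (v.1, j)) v.2

variable (K) in
/-- **`σ_c : K[U] → T`**, `u_{ij} ↦ u_{ij}` (`j ≠ c`), `u_{ic} ↦ wᵢ = −∑_{j ≠ c} u_{ij} yⱼ`.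
[cite: NesterenkoPhilippon2001, Ch. 3 Def. 4.3 (p. 38)] -/
def sigmaU (r m : ℕ) (c : Fin (m + 1)) : (MvPolynomial (Fin r × Fin (m + 1)) K) →ₐ[K] (MvPolynomial (Fin r × Fin m) (MvPolynomial (Fin m) K)) :=
  aeval (sigmaUVal K r m c)

variable (K) in
/-- **`Σ_c : K[U, x̲] → T`**: `σ_c` on the `u_{ij}` and dehomogenisation `xⱼ ↦ xⱼ(x_c := 1)` on
the `xⱼ`. [cite: NesterenkoPhilippon2001, Ch. 3 Def. 4.3 (p. 38)] -/
def sigmaUX (r m : ℕ) (c : Fin (m + 1)) : (MvPolynomial ((Fin r × Fin (m + 1)) ⊕ Fin (m + 1)) K) →ₐ[K] (MvPolynomial (Fin r × Fin m) (MvPolynomial (Fin m) K)) :=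
  aeval (Sum.elim (sigmaUVal K r m c) fun j => C (ProjectiveSpace.dehomogenize K c (X j)))

/-- `σ_c` on a variable (unfolding). [folklore] -/
@[simp] theorem sigmaU_X (r m : ℕ) (c : Fin (m + 1)) (v : Fin r × Fin (m + 1)) :
    sigmaU K r m c (X v) = sigmaUVal K r m c v := by
  simp [sigmaU]

/-- `σ_c(u_{ic}) = wᵢ` (unfolding). [folklore] -/
theorem sigmaUVal_same (r m : ℕ) (c : Fin (m + 1)) (i : Fin r) :
    sigmaUVal K r m c (i, c) = wForm K r m i := by
  simp [sigmaUVal]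

/-- `σ_c(u_{i, c.succAbove j}) = u_{ij}` (unfolding). [folklore] -/
theorem sigmaUVal_succAbove (r m : ℕ) (c : Fin (m + 1)) (i : Fin r) (j : Fin m) :
    sigmaUVal K r m c (i, c.succAbove j) = X (i, j) := by
  simp [sigmaUVal]

/-- `Σ_c` extends `σ_c`. [folklore] -/
theorem sigmaUX_rename_inl (r m : ℕ) (c : Fin (m + 1)) (G : (MvPolynomial (Fin r × Fin (m + 1)) K)) :
    sigmaUX K r m c (rename Sum.inl G) = sigmaU K r m c G := by
  rw [sigmaUX, aeval_rename, sigmaU]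
  rfl

/-- `Σ_c` is dehomogenisation on `K[x̲]`. [folklore] -/
theorem sigmaUX_rename_inr (r m : ℕ) (c : Fin (m + 1)) (P : (MvPolynomial (Fin (m + 1)) K)) :
    sigmaUX K r m c (rename Sum.inr P) = C (ProjectiveSpace.dehomogenize K c P) := by
  rw [sigmaUX, aeval_rename]
  change aeval (fun j => C (ProjectiveSpace.dehomogenize K c (X j))) P = _
  have h : (aeval fun j : Fin (m + 1) => (C (ProjectiveSpace.dehomogenize K c (X j)) : (MvPolynomial (Fin r × Fin m) (MvPolynomial (Fin m) K)))) =
      ((IsScalarTower.toAlgHom K ((MvPolynomial (Fin m) K)) ((MvPolynomial (Fin r × Fin m) (MvPolynomial (Fin m) K)))).comp (ProjectiveSpace.dehomogenize K c)) := by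
    refine MvPolynomial.algHom_ext fun j => ?_
    simp
  rw [h]
  rfl

/-- `Σ_c(x_c) = 1`. [folklore] -/
theorem sigmaUX_X_inr_self (r m : ℕ) (c : Fin (m + 1)) :
    sigmaUX K r m c (X (Sum.inr c)) = 1 := by
  have := sigmaUX_rename_inr (K := K) r m c (X c)
  rwa [rename_X, ProjectiveSpace.dehomogenize_X_self, C_1] at this

/-- **`Σ_c` kills the linear forms**: `Σ_c(Lᵢ) = wᵢ + ∑_{j ≠ c} u_{ij} yⱼ = 0`.
[cite: NesterenkoPhilippon2001, Ch. 3 Def. 4.3 (p. 38)] -/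
theorem sigmaUX_linForm (r m : ℕ) (c : Fin (m + 1)) (i : Fin r) :
    sigmaUX K r m c (linForm K r m i) = 0 := by
  have hx : ∀ j, sigmaUX K r m c (X (Sum.inr j)) = C (ProjectiveSpace.dehomogenize K c (X j)) :=
    fun j => by simpa using sigmaUX_rename_inr r m c (X j)
  have hu : ∀ v, sigmaUX K r m c (X (Sum.inl v)) = sigmaUVal K r m c v := fun v => by
    simp [sigmaUX]
  simp only [linForm, map_sum, map_mul, hx, hu]
  rw [Fin.sum_univ_succAbove _ c, sigmaUVal_same, ProjectiveSpace.dehomogenize_X_self, C_1,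
    mul_one]
  simp only [sigmaUVal_succAbove, ProjectiveSpace.dehomogenize_X_succAbove]
  rw [wForm, neg_add_cancel]

/-- `Σ_c` maps `(J, L₁, …, L_r)` into `J' · T`. [folklore] -/
theorem map_sigmaUX_extIdeal_le (r : ℕ) (c : Fin (m + 1)) (J : Ideal (MvPolynomial (Fin (m + 1)) K)) :
    (extIdeal J r).map (sigmaUX K r m c) ≤ (affIdeal c J).map (C : (MvPolynomial (Fin m) K) →+* (MvPolynomial (Fin r × Fin m) (MvPolynomial (Fin m) K))) := by
  rw [extIdeal, Ideal.map_sup, sup_le_iff]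
  constructor
  · rw [Ideal.map_le_iff_le_comap, Ideal.map_le_iff_le_comap]
    intro P hP
    rw [Ideal.mem_comap, Ideal.mem_comap]
    change sigmaUX K r m c (rename Sum.inr P) ∈ _
    rw [sigmaUX_rename_inr]
    exact Ideal.mem_map_of_mem _ (dehomogenize_mem_affIdeal c hP)
  · rw [Ideal.map_span, Ideal.span_le]
    rintro _ ⟨_, ⟨i, rfl⟩, rfl⟩
    rw [SetLike.mem_coe, sigmaUX_linForm]
    exact zero_mem _

/-- **Chart criterion, easy direction.** If `G x_c^N ∈ (J, L₁, …, L_r)` then `σ_c(G) ∈ J' T`.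
[cite: NesterenkoPhilippon2001, Ch. 3 Def. 4.3 (p. 38)] -/
theorem sigmaU_mem_of_mul_X_pow_mem {r : ℕ} (c : Fin (m + 1)) {J : Ideal (MvPolynomial (Fin (m + 1)) K)} {G : (MvPolynomial (Fin r × Fin (m + 1)) K)}
    {N : ℕ} (h : rename Sum.inl G * X (Sum.inr c) ^ N ∈ extIdeal J r) :
    sigmaU K r m c G ∈ (affIdeal c J).map (C : (MvPolynomial (Fin m) K) →+* (MvPolynomial (Fin r × Fin m) (MvPolynomial (Fin m) K))) := by
  have := map_sigmaUX_extIdeal_le r c J (Ideal.mem_map_of_mem (sigmaUX K r m c) h)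
  rwa [map_mul, map_pow, sigmaUX_X_inr_self, one_pow, mul_one, sigmaUX_rename_inl] at this

/-- Hence `G ∈ Ī(r) ⇒ σ_c(G) ∈ J' T` on every chart. [cite: NesterenkoPhilippon2001, Ch. 3 Def. 4.3 (p. 38)] -/
theorem sigmaU_mem_of_mem_elimIdeal {r : ℕ} (c : Fin (m + 1)) {J : Ideal (MvPolynomial (Fin (m + 1)) K)} {G : (MvPolynomial (Fin r × Fin (m + 1)) K)}
    (hG : G ∈ elimIdeal J r) : sigmaU K r m c G ∈ (affIdeal c J).map (C : (MvPolynomial (Fin m) K) →+* (MvPolynomial (Fin r × Fin m) (MvPolynomial (Fin m) K))) := by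
  obtain ⟨M, -, hM⟩ := hG
  exact sigmaU_mem_of_mul_X_pow_mem c (hM c)

/-! ### The hard direction: re-homogenisation in `K[U, x̲][1/x_c]` -/

/-- Substituting congruent values gives congruent results: if `p v − q v ∈ 𝔞` for all `v` then
`G(p) − G(q) ∈ 𝔞`. [folklore] -/
theorem aeval_sub_aeval_mem_of_forall_sub_mem {τ B : Type*} [CommRing B] [Algebra K B]
    {p q : τ → B} {𝔞 : Ideal B} (h : ∀ v, p v - q v ∈ 𝔞) (G : MvPolynomial τ K) :
    aeval p G - aeval q G ∈ 𝔞 := by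
  rw [← Ideal.Quotient.eq, ← Ideal.Quotient.mkₐ_eq_mk K, ← AlgHom.comp_apply, ← AlgHom.comp_apply,
    MvPolynomial.comp_aeval, MvPolynomial.comp_aeval]
  congr 2
  funext v
  exact (Ideal.Quotient.mkₐ_eq_mk K 𝔞 ▸ Ideal.Quotient.eq.mpr (h v) :)

/-- **Chart criterion, hard direction.** For a HOMOGENEOUS ideal `J`: if `σ_c(G) ∈ J' T` then
`G x_c^N ∈ (J, L₁, …, L_r)` for some `N > 0`. Proof in `S = K[U, x̲][1/x_c]`: let
`ρ : T → S`, `yⱼ ↦ x_{c.succAbove j}/x_c`, `u_{ij} ↦ u_{ij}`; then `ρ ∘ σ_c` is evaluation at a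
point congruent to `(u_{ij})` modulo the `Lᵢ/x_c`, so `G ≡ ρ(σ_c G)` modulo `(L)S`; and
`ρ(P(x_c := 1)) = P/x_cᵉ ∈ J S` for every form `P ∈ J` of degree `e` (Euler), so `ρ(J' T) ⊆ J S`.
Hence `G ∈ (J, L) S`, i.e. `x_cⁿ G ∈ (J, L)`. [cite: NesterenkoPhilippon2001, Ch. 3 Def. 4.3 (p. 38)] -/
theorem exists_mul_X_pow_mem_of_sigmaU_mem {r : ℕ} (c : Fin (m + 1)) {J : Ideal (MvPolynomial (Fin (m + 1)) K)}
    (hJ : J.IsHomogeneous (homogeneousSubmodule (Fin (m + 1)) K)) {G : (MvPolynomial (Fin r × Fin (m + 1)) K)}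
    (h : sigmaU K r m c G ∈ (affIdeal c J).map (C : (MvPolynomial (Fin m) K) →+* (MvPolynomial (Fin r × Fin m) (MvPolynomial (Fin m) K)))) :
    ∃ N : ℕ, 0 < N ∧ rename Sum.inl G * X (Sum.inr c) ^ N ∈ extIdeal J r := by
  classical
  set xc : (MvPolynomial ((Fin r × Fin (m + 1)) ⊕ Fin (m + 1)) K) := X (Sum.inr c) with hxc
  let S := Localization.Away xc
  let ι : (MvPolynomial ((Fin r × Fin (m + 1)) ⊕ Fin (m + 1)) K) →+* S := algebraMap ((MvPolynomial ((Fin r × Fin (m + 1)) ⊕ Fin (m + 1)) K)) S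
  set xinv : S := IsLocalization.Away.invSelf (S := S) xc with hxinv
  have hxinv : ι xc * xinv = 1 := IsLocalization.Away.mul_invSelf (S := S) xc
  have hxinv' : xinv * ι xc = 1 := by rw [mul_comm, hxinv]
  -- `ρ₀ : K[y] → S`, `y_j ↦ x_{c.succAbove j} / x_c`, and `ρ : T → S`
  let ρ₀ : (MvPolynomial (Fin m) K) →ₐ[K] S := aeval fun j => xinv * ι (X (Sum.inr (c.succAbove j)))
  let ρ : (MvPolynomial (Fin r × Fin m) (MvPolynomial (Fin m) K)) →ₐ[K] S := aevalTower ρ₀ fun v => ι (X (Sum.inl (v.1, c.succAbove v.2)))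
  set E : Ideal S := (extIdeal J r).map ι with hE
  -- (1) `ρ₀ (P(x_c := 1)) = xinv^e * P` for forms `P`, hence `ρ₀ (J') ⊆ E`
  have hρ₀d : ∀ P : (MvPolynomial (Fin (m + 1)) K), ρ₀ (ProjectiveSpace.dehomogenize K c P) =
      aeval (fun j => xinv * ι (X (Sum.inr j))) P := by
    intro P
    rw [ProjectiveSpace.dehomogenize, ← AlgHom.comp_apply]
    congr 1
    refine MvPolynomial.algHom_ext fun j => ?_
    rw [AlgHom.comp_apply, aeval_X, aeval_X]
    rcases Fin.eq_self_or_eq_succAbove c j with rfl | ⟨j', rfl⟩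
    · rw [Fin.insertNth_apply_same, map_one, ← hxc]
      exact hxinv'.symm
    · simp [ρ₀]
  have hιP : ∀ P : (MvPolynomial (Fin (m + 1)) K), aeval (fun j => ι (X (Sum.inr j))) P = ι (rename Sum.inr P) := by
    intro P
    have e : (aeval fun j => ι (X (Sum.inr j))) =
        (IsScalarTower.toAlgHom K ((MvPolynomial ((Fin r × Fin (m + 1)) ⊕ Fin (m + 1)) K)) S).comp (rename Sum.inr) :=
      MvPolynomial.algHom_ext fun j => by simp [ι]
    rw [e]
    rfl
  have hρ₀J : ∀ a ∈ affIdeal c J, ρ₀ a ∈ E := by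
    intro a ha
    obtain ⟨P, hPJ, rfl⟩ := (mem_affIdeal_iff c J a).mp ha
    rw [hρ₀d, ← sum_homogeneousComponent P, map_sum]
    refine Ideal.sum_mem _ fun k _ => ?_
    have hk : homogeneousComponent k P ∈ J := homogeneousComponent_mem_of_isHomogeneous hJ hPJ k
    rw [ProjectiveSpace.isHomogeneous_aeval_const_mul (homogeneousComponent_isHomogeneous k P), hιP]
    exact Ideal.mul_mem_left _ _
      (Ideal.mem_map_of_mem ι (Ideal.mem_sup_left (Ideal.mem_map_of_mem _ hk)))
  -- (2) `ρ (σ_c G) ∈ E`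
  have hρσ : ρ (sigmaU K r m c G) ∈ E := by
    rw [(sigmaU K r m c G).as_sum, map_sum]
    refine Ideal.sum_mem _ fun α _ => ?_
    rw [← mul_one (coeff α _), ← C_mul_monomial, map_mul]
    refine Ideal.mul_mem_right _ _ ?_
    change aevalTower ρ₀ _ (C (coeff α (sigmaU K r m c G))) ∈ E
    rw [aevalTower_C]
    exact hρ₀J _ ((mem_map_C_iff.mp h) α)
  -- (3) `ρ ∘ σ_c = aeval p` with `p ≡ q := ι ∘ X ∘ inl` modulo `E`
  have hpq : ∀ v : Fin r × Fin (m + 1),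
      (ρ.comp (sigmaU K r m c)) (X v) - ι (X (Sum.inl v)) ∈ E := by
    rintro ⟨i, j⟩
    rcases Fin.eq_self_or_eq_succAbove c j with hj | ⟨j', hj⟩
    · -- `u_{ic}`: `ρ (w_i) - u_{ic} = -xinv * L_i`
      rw [hj]
      have hL : ι (linForm K r m i) ∈ E :=
        Ideal.mem_map_of_mem ι (Ideal.mem_sup_right (Ideal.subset_span ⟨i, rfl⟩))
      have key : (ρ.comp (sigmaU K r m c)) (X (i, c)) - ι (X (Sum.inl (i, c))) =
          -(xinv * ι (linForm K r m i)) := by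
        rw [AlgHom.comp_apply, sigmaU_X, sigmaUVal_same, wForm, map_neg, map_sum, linForm, map_sum,
          Finset.mul_sum, Fin.sum_univ_succAbove _ c]
        simp only [map_mul, ρ, aevalTower_X, aevalTower_C, ρ₀, aeval_X]
        rw [show xinv * (ι (X (Sum.inl (i, c))) * ι (X (Sum.inr c))) = ι (X (Sum.inl (i, c))) by
          rw [mul_left_comm, ← hxc, hxinv', mul_one]]
        have : ∀ x : Fin m, xinv * (ι (X (Sum.inl (i, c.succAbove x))) * ι (X (Sum.inr (c.succAbove x))))
            = ι (X (Sum.inl (i, c.succAbove x))) * (xinv * ι (X (Sum.inr (c.succAbove x)))) :=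
          fun x => by ring
        simp only [this]
        ring
      rw [key]
      exact E.neg_mem (Ideal.mul_mem_left _ _ hL)
    · subst hj
      have : (ρ.comp (sigmaU K r m c)) (X (i, c.succAbove j')) = ι (X (Sum.inl (i, c.succAbove j'))) := by
        rw [AlgHom.comp_apply, sigmaU_X, sigmaUVal_succAbove]
        simp [ρ]
      rw [this, sub_self]
      exact zero_mem _
  have hq : aeval (fun v => ι (X (Sum.inl v))) G = ι (rename Sum.inl G) := by
    have e : (aeval fun v => ι (X (Sum.inl v))) =
        (IsScalarTower.toAlgHom K ((MvPolynomial ((Fin r × Fin (m + 1)) ⊕ Fin (m + 1)) K)) S).comp (rename Sum.inl) :=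
      MvPolynomial.algHom_ext fun v => by simp [ι]
    rw [e]
    rfl
  have hp : aeval (fun v => (ρ.comp (sigmaU K r m c)) (X v)) G = ρ (sigmaU K r m c G) := by
    rw [show (fun v => (ρ.comp (sigmaU K r m c)) (X v)) = (ρ.comp (sigmaU K r m c)) ∘ X from rfl,
      ← MvPolynomial.aeval_unique]
    rfl
  -- (4) conclude: `ι (rename inl G) ∈ E`
  have hmem : ι (rename Sum.inl G) ∈ E := by
    have h1 := aeval_sub_aeval_mem_of_forall_sub_mem hpq G
    rw [hq, hp] at h1
    have := E.sub_mem hρσ h1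
    rwa [sub_sub_cancel] at this
  obtain ⟨s, hs, hsG⟩ := (IsLocalization.algebraMap_mem_map_algebraMap_iff (Submonoid.powers xc) S
    (extIdeal J r) (rename Sum.inl G)).mp hmem
  obtain ⟨n, rfl⟩ := (Submonoid.mem_powers_iff _ _).mp hs
  refine ⟨n + 1, Nat.succ_pos n, ?_⟩
  rw [pow_succ, ← mul_assoc, mul_comm (rename Sum.inl G)]
  exact Ideal.mul_mem_right _ _ hsG

/-- **`Ī(r)` through the charts.** For a homogeneous ideal `J ⊆ K[x₀, …, x_m]` and `G ∈ K[U]`: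
`G ∈ Ī(r)` iff `σ_c(G) ∈ J'_c · T` for every chart `c`.
[cite: NesterenkoPhilippon2001, Ch. 3 Def. 4.3 (p. 38)] -/
theorem mem_elimIdeal_iff_forall_sigmaU_mem {r : ℕ} {J : Ideal (MvPolynomial (Fin (m + 1)) K)}
    (hJ : J.IsHomogeneous (homogeneousSubmodule (Fin (m + 1)) K)) (G : (MvPolynomial (Fin r × Fin (m + 1)) K)) :
    G ∈ elimIdeal J r ↔ ∀ c, sigmaU K r m c G ∈ (affIdeal c J).map (C : (MvPolynomial (Fin m) K) →+* (MvPolynomial (Fin r × Fin m) (MvPolynomial (Fin m) K))) := by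
  refine ⟨fun hG c => sigmaU_mem_of_mem_elimIdeal c hG, fun h => ?_⟩
  choose N hNpos hN using fun c => exists_mul_X_pow_mem_of_sigmaU_mem c hJ (h c)
  refine ⟨∑ c, N c, Finset.sum_pos (fun c _ => hNpos c) Finset.univ_nonempty, fun j => ?_⟩
  · have hle : N j ≤ ∑ c, N c :=
      Finset.single_le_sum (f := N) (fun _ _ => Nat.zero_le _) (Finset.mem_univ j)
    obtain ⟨d, hd⟩ := Nat.exists_eq_add_of_le hle
    rw [hd, pow_add, ← mul_assoc]
    exact Ideal.mul_mem_right _ _ (hN j)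

end NesterenkoK

end Literature.NumberTheory.Transcendental
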